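import Summits.QuantumFields.YangMills.Theorems.BalabanLadderUVSeamRecCeilingsDefectCollar
import HarnessLib

/-!
# Crux `UVSeamRec` (stmt-QuantumFields-20043), stub `stub_ceilings` (E0′): ceilings from a good-exterior kernel law plus
# multiplicative rarity — the route-vocabulary corollaries of the defect collar

Helper file (`--supports stmt-QuantumFields-20043`) of the stub seat `ym-20043-seam-s2`; sibling of
`BalabanLadderUVSeamRecCeilingsDefectCollar.lean` (§1 there: the collar identity and the defect collar
`DefectCollar.abs_integral_prod_sub_mean_le_of_defects` on a torus of any side).  HONEST FRAMING: consumption-side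
theorems for OPEN hypotheses of a conditional chain (the good-exterior law (a) is a background-field form of E0′, the
rarity (b) a chessboard / large-field-suppression statement); nothing of E0′ is claimed; not a gap, not Clay.

* §2 `momentBounds6_of_goodLaw_and_rarity` — the registered odd-torus currency `DlrCollarTransfer.MomentBounds6 G r a`
  from (a) the plane-resolved centre law on a measurable set of GOOD exteriors of the radius-`R+1` cube (`C₁/R⁴`) and
  (b) multiplicative rarity `(C₂/R⁴)^{#T}` of bad cube-exteriors at cyclically separated sites on every odd torus;
  constant `2C₁ + 2(C_A + P₀)C₂`.  At `Good = univ`, `C₂ = 0` it is the landed `stub_collar6`.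
* §3 `momentBounds6OnSides_of_goodLaw_and_rarity` — the same for the class currency
  `TorusClass.MomentBounds6OnSides G r a 𝓣` (p464599); on Track A's even class `familySides` a chessboard estimate is the
  intended supplier of (b).
* §4 `abs_integral_prod_sub_mean_le_of_tame` — the ADDITIVE (tame) collar on a torus of any side: good-exterior law +
  single-event rarity `∫ 1_{Goodᵢᶜ}(lift) dμ ≤ δ` (no multiplicativity) ⇒ `|⟨∏(Aᵢ − ⟨Aᵢ⟩)⟩| ≤ ε'ⁿ + n(ε' + K)ⁿδ`,
  `ε' = 2ε + Kδ`, `K = C_A + |p|` (lead ym-spine-20043-p1 g7, ORDER 09:03Z item (3); the form a fixed number of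
  insertions consumes).

References: H.-O. Georgii, *Gibbs Measures and Phase Transitions* (2011) Thm. 4.17; E. Seiler, LNP 159 (1982) Ch. 2;
J. Fröhlich, R. Israel, E. H. Lieb, B. Simon, Commun. Math. Phys. 62 (1978) §4.
-/

set_option autoImplicit false

noncomputable section

open MeasureTheory Filter Topology Finset
open Literature.Probability.LatticeModels
open Literature.MathematicalPhysics.QuantumFieldTheory (GaugeConfig wilsonMeasure isProbabilityMeasure_wilsonMeasure
  measurable_torusLift LatticeRep)
open Literature.MathematicalPhysics.QuantumLattice

namespace Summit.QuantumFields.YangMills.Cruxes.UVSeamRec.DefectCollar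

/-! ## §2 The registered odd-torus currency `MomentBounds6` from a good-exterior law plus multiplicative rarity -/

section Route

open Summit.QuantumFields.YangMills.Cruxes.OSLegsFromFemtoAndGap.DlrCollarTransfer
open Summit.QuantumFields.YangMills.Cruxes.UV.TorusClass

variable {G : Type} [Group G] [TopologicalSpace G] [IsTopologicalGroup G] [CompactSpace G]
  [MeasurableSpace G] [BorelSpace G] (r : LatticeRep G) (a : ℝ → ℝ)

/-- **`MomentBounds6` from a kernel law on GOOD exteriors and multiplicative rarity of the bad ones.**  Data: for each
coupling `β`, collar radius `R`, orientation `q` and site `x` a measurable set `Good β R q x` of configurations of `ℤ⁴`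
(read as exteriors of the radius-`R+1` cube `x − (R+1) + [0, 2R+3)⁴` around `x`), reference values `p q β` bounded by
`P₀`, and constants `C₁, C₂ ≥ 0`, `ℓ₁ > 0`, `β₁`, such that for `β ≥ β₁`, `1 ≤ R`, `R · a β ≤ ℓ₁`:
(a) GOOD-EXTERIOR CENTRE LAW — for `η ∈ Good β R q x` the cube-kernel mean of the single-plane field `plane q x`
(`q.1 < q.2`) is within `C₁/R⁴` of `p q β`; (b) MULTIPLICATIVE RARITY — on every odd torus `(ℤ/(2L+1))⁴` with
`4R+8 ≤ L`, for sites `x i` pairwise cyclically `2R+4`-separated in some coordinate and every set `T` of indices, the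
torus expectation of `∏_{i∈T} 1[lift ∉ Good β R (q i) (x i)]` is at most `(C₂/R⁴)^{#T}`.  THEN `MomentBounds6 G r a` holds
with `C = 2C₁ + 2(C_A + P₀)C₂` (`C_A` = the uniform bound of the single-plane fields), `β₄ = β₁`, `ℓ₄ = ℓ₁`.  At
`Good = univ`, `C₂ = 0` this is the landed `stub_collar6` (there (a) is `FBL6` at the centre).  Proof: §1
`abs_integral_prod_sub_mean_le_of_defects` on the radius-`R+1` cubes with the shifted observables `plane (q i) (x i) − p (q i) β`
(common reference value `0`), geometry of the landed collar (`injOn_torusProj_cube`, `torusEdge_ne_cube`). [folklore: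
Georgii (2011) Thm. 4.17 for the DLR part] -/
theorem momentBounds6_of_goodLaw_and_rarity {C₁ C₂ β₁ ℓ₁ P₀ : ℝ} {p : Fin 4 × Fin 4 → ℝ → ℝ}
    (Good : ℝ → ℕ → Fin 4 × Fin 4 → (Fin 4 → ℤ) → Set (LGConfig 4 G))
    (hℓ₁ : 0 < ℓ₁) (hC₁ : 0 ≤ C₁) (hC₂ : 0 ≤ C₂) (hp : ∀ q β, |p q β| ≤ P₀)
    (hGood : ∀ β R q x, MeasurableSet (Good β R q x))
    (hlaw : ∀ β : ℝ, β₁ ≤ β → ∀ R : ℕ, 1 ≤ R → (R : ℝ) * a β ≤ ℓ₁ →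
      ∀ (q : Fin 4 × Fin 4) (x : Fin 4 → ℤ), q.1 < q.2 → ∀ η ∈ Good β R q x,
        |kerE G r β (fun k => x k - (R + 1)) (2 * R + 3) η (plane G r q x) - p q β| ≤ C₁ / (R : ℝ) ^ 4)
    (hrare : ∀ β : ℝ, β₁ ≤ β → ∀ (L n : ℕ) (q : Fin n → Fin 4 × Fin 4) (x : Fin n → (Fin 4 → ℤ)) (R : ℕ),
      (∀ i, (q i).1 < (q i).2) → 1 ≤ R → (R : ℝ) * a β ≤ ℓ₁ → 4 * R + 8 ≤ L →
      (∀ i j : Fin n, i ≠ j → ∃ k : Fin 4,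
        (2 * (R : ℤ) + 4) ≤ |((((x i k - x j k : ℤ) : ZMod (2 * L + 1))).valMinAbs : ℤ)|) →
      ∀ T : Finset (Fin n),
        torusE G r β L (fun U => ∏ i ∈ T, (Good β R (q i) (x i))ᶜ.indicator (fun _ => (1 : ℝ)) U) ≤
          (C₂ / (R : ℝ) ^ 4) ^ T.card) :
    MomentBounds6 G r a := by
  haveI : SecondCountableTopology G :=
    (r.continuous.isClosedEmbedding r.injective).isEmbedding.secondCountableTopology
  obtain ⟨CA, hCA⟩ := exists_abs_plane_le r
  have hP₀ : 0 ≤ P₀ := (abs_nonneg _).trans (hp (0, 1) 0)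
  have hCA0 : 0 ≤ CA := (abs_nonneg _).trans (hCA (0, 1) 0 fun _ => 1)
  refine ⟨2 * C₁ + 2 * (CA + P₀) * C₂, β₁, ℓ₁, hℓ₁, by positivity, ?_⟩
  intro β hβ L n q x R hq hR hRa hRL hsep
  haveI := isProbabilityMeasure_wilsonMeasure (d := 4) (L := 2 * L + 1) r.ρ r.continuous β
  have hR0 : (0 : ℝ) < (R : ℝ) ^ 4 := by positivity
  -- data of the defect collar: shifted observables, cubes, good sets
  have hmeas : ∀ i : Fin n, Measurable (plane G r (q i) (x i)) := fun i =>
    (continuous_plane r (q i) (x i)).measurable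
  have hAc : ∀ i : Fin n, Continuous fun U => plane G r (q i) (x i) U - p (q i) β := fun i =>
    (continuous_plane r (q i) (x i)).sub continuous_const
  have hAb : ∀ (i : Fin n) (U : LGConfig 4 G), |plane G r (q i) (x i) U - p (q i) β| ≤ CA + P₀ :=
    fun i U => (abs_sub _ _).trans (add_le_add (hCA _ _ _) (hp _ _))
  have hAS : ∀ i : Fin n, IsCylinder (fun U => plane G r (q i) (x i) U - p (q i) β)
      (cubeEdges (fun k => x i k - (R + 1)) (2 * R + 3)) :=
    fun i U V hUV => by simp only [isCylinder_plane_cube r hR (q i) (x i) hUV]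
  have hinj : ∀ i : Fin n, Set.InjOn (Torus.proj (2 * L + 1))
      (((cubeEdges (fun k => x i k - (R + 1)) (2 * R + 3) ∪ cubeEdges (fun k => x i k - (R + 1)) (2 * R + 3) ∪
          (plaquettesTouching (cubeEdges (fun k => x i k - (R + 1)) (2 * R + 3))).biUnion plaquetteEdges).image
          Prod.fst : Set (Fin 4 → ℤ))) := fun i => injOn_torusProj_cube hRL (x i)
  have hfar : ∀ i j : Fin n, i ≠ j → ∀ e ∈ cubeEdges (fun k => x j k - (R + 1)) (2 * R + 3) ∪
      (plaquettesTouching (cubeEdges (fun k => x j k - (R + 1)) (2 * R + 3))).biUnion plaquetteEdges,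
      ∀ e' ∈ cubeEdges (fun k => x i k - (R + 1)) (2 * R + 3),
      torusEdge (2 * L + 1) e ≠ torusEdge (2 * L + 1) e' :=
    fun i j hij e he e' he' => torusEdge_ne_cube (hsep i j hij) he he'
  have hm : ∀ i : Fin n, torusE G r β L (plane G r (q i) (x i)) - p (q i) β =
      ∫ W, (plane G r (q i) (x i) (torusLift (2 * L + 1) W) - p (q i) β)
        ∂(wilsonMeasure (d := 4) (L := 2 * L + 1) r.ρ β) := fun i =>
    (integral_sub_const_of_abs_le (μ := wilsonMeasure (d := 4) (L := 2 * L + 1) r.ρ β)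
      ((continuous_plane r (q i) (x i)).comp (continuous_torusLift (2 * L + 1))).measurable
      (fun W => hCA (q i) (x i) (torusLift (2 * L + 1) W)) (p (q i) β)).symm
  have hker : ∀ (i : Fin n), ∀ η ∈ Good β R (q i) (x i),
      |(∫ U, (plane G r (q i) (x i) U - p (q i) β) ∂(ymSpecification r.ρ β
        (cubeEdges (fun k => x i k - (R + 1)) (2 * R + 3)) η)) - 0| ≤ C₁ / (R : ℝ) ^ 4 := fun i η hη => by
    haveI := isProbabilityMeasure_ymSpecification r.ρ r.continuous β
      (cubeEdges (fun k => x i k - (R + 1)) (2 * R + 3)) η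
    rw [sub_zero, integral_sub_const_of_abs_le (hmeas i) (fun U => hCA (q i) (x i) U) (p (q i) β)]
    exact hlaw β hβ R hR hRa (q i) (x i) (hq i) η hη
  have hrare' : ∀ T : Finset (Fin n),
      ∫ V, ∏ i ∈ T, (Good β R (q i) (x i))ᶜ.indicator (fun _ => (1 : ℝ)) (torusLift (2 * L + 1) V)
        ∂(wilsonMeasure (d := 4) (L := 2 * L + 1) r.ρ β) ≤ (C₂ / (R : ℝ) ^ 4) ^ T.card :=
    fun T => hrare β hβ L n q x R hq hR hRa hRL hsep T
  have key := abs_integral_prod_sub_mean_le_of_defects (d := 4) r.ρ r.continuous β (L := 2 * L + 1) (n := n)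
      (fun i => cubeEdges (fun k => x i k - (R + 1)) (2 * R + 3))
      (fun i => cubeEdges (fun k => x i k - (R + 1)) (2 * R + 3))
      (fun i U => plane G r (q i) (x i) U - p (q i) β) hAc hAb hAS hinj hfar
      (fun i => torusE G r β L (plane G r (q i) (x i)) - p (q i) β) hm
      (fun i => Good β R (q i) (x i)) (fun i => hGood β R (q i) (x i))
      (p := 0) (ε := C₁ / (R : ℝ) ^ 4) (δ := C₂ / (R : ℝ) ^ 4) (by positivity) (by positivity) hker hrare'
  simp only [sub_sub_sub_cancel_right, abs_zero, add_zero] at key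
  refine key.trans (le_of_eq ?_)
  congr 1
  field_simp

/-! ## §3 The class currency `MomentBounds6OnSides 𝓣` (Track A's even family and every other class) likewise -/

/-- **`MomentBounds6OnSides G r a 𝓣` from a good-exterior law plus multiplicative rarity on the tori of the class.**
The twin of `momentBounds6_of_goodLaw_and_rarity` for the class-parametric ceilings (p464599, VERBATIM `MomentBounds6`
with `2L+1 ↦ M ∈ 𝓣`, half-side clause `8R+16 ≤ M`): the same good-exterior centre law (a) (kernel statements mention no
torus) and multiplicative rarity (b) asked on the tori `(ℤ/Mℤ)⁴`, `M ∈ 𝓣`, `8R+16 ≤ M`, give the class ceilings with the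
same constant `2C₁ + 2(C_A + P₀)C₂`.  On Track A's even class `𝓣 = familySides` (sides `2·L^{m+K}`, odd block widths
tile) a chessboard estimate is the intended supplier of (b); geometry from `TorusClass.injOn_torusProj_cube_side` /
`torusEdge_ne_cube_side`. [folklore: Georgii (2011) Thm. 4.17 for the DLR part] -/
theorem momentBounds6OnSides_of_goodLaw_and_rarity (𝓣 : Set ℕ) {C₁ C₂ β₁ ℓ₁ P₀ : ℝ}
    {p : Fin 4 × Fin 4 → ℝ → ℝ}
    (Good : ℝ → ℕ → Fin 4 × Fin 4 → (Fin 4 → ℤ) → Set (LGConfig 4 G))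
    (hℓ₁ : 0 < ℓ₁) (hC₁ : 0 ≤ C₁) (hC₂ : 0 ≤ C₂) (hp : ∀ q β, |p q β| ≤ P₀)
    (hGood : ∀ β R q x, MeasurableSet (Good β R q x))
    (hlaw : ∀ β : ℝ, β₁ ≤ β → ∀ R : ℕ, 1 ≤ R → (R : ℝ) * a β ≤ ℓ₁ →
      ∀ (q : Fin 4 × Fin 4) (x : Fin 4 → ℤ), q.1 < q.2 → ∀ η ∈ Good β R q x,
        |kerE G r β (fun k => x k - (R + 1)) (2 * R + 3) η (plane G r q x) - p q β| ≤ C₁ / (R : ℝ) ^ 4)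
    (hrare : ∀ β : ℝ, β₁ ≤ β → ∀ (M : ℕ) [NeZero M], M ∈ 𝓣 →
      ∀ (n : ℕ) (q : Fin n → Fin 4 × Fin 4) (x : Fin n → (Fin 4 → ℤ)) (R : ℕ),
      (∀ i, (q i).1 < (q i).2) → 1 ≤ R → (R : ℝ) * a β ≤ ℓ₁ → 8 * R + 16 ≤ M →
      (∀ i j : Fin n, i ≠ j → ∃ k : Fin 4,
        (2 * (R : ℤ) + 4) ≤ |((((x i k - x j k : ℤ) : ZMod M)).valMinAbs : ℤ)|) →
      ∀ T : Finset (Fin n),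
        torusEOn G r β M (fun U => ∏ i ∈ T, (Good β R (q i) (x i))ᶜ.indicator (fun _ => (1 : ℝ)) U) ≤
          (C₂ / (R : ℝ) ^ 4) ^ T.card) :
    MomentBounds6OnSides G r a 𝓣 := by
  haveI : SecondCountableTopology G :=
    (r.continuous.isClosedEmbedding r.injective).isEmbedding.secondCountableTopology
  obtain ⟨CA, hCA⟩ := exists_abs_plane_le r
  have hP₀ : 0 ≤ P₀ := (abs_nonneg _).trans (hp (0, 1) 0)
  have hCA0 : 0 ≤ CA := (abs_nonneg _).trans (hCA (0, 1) 0 fun _ => 1)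
  refine ⟨2 * C₁ + 2 * (CA + P₀) * C₂, β₁, ℓ₁, hℓ₁, by positivity, ?_⟩
  intro β hβ M _ hM n q x R hq hR hRa hRM hsep
  haveI := isProbabilityMeasure_wilsonMeasure (d := 4) (L := M) r.ρ r.continuous β
  have hR0 : (0 : ℝ) < (R : ℝ) ^ 4 := by positivity
  have hmeas : ∀ i : Fin n, Measurable (plane G r (q i) (x i)) := fun i =>
    (continuous_plane r (q i) (x i)).measurable
  have hAc : ∀ i : Fin n, Continuous fun U => plane G r (q i) (x i) U - p (q i) β := fun i =>
    (continuous_plane r (q i) (x i)).sub continuous_const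
  have hAb : ∀ (i : Fin n) (U : LGConfig 4 G), |plane G r (q i) (x i) U - p (q i) β| ≤ CA + P₀ :=
    fun i U => (abs_sub _ _).trans (add_le_add (hCA _ _ _) (hp _ _))
  have hAS : ∀ i : Fin n, IsCylinder (fun U => plane G r (q i) (x i) U - p (q i) β)
      (cubeEdges (fun k => x i k - (R + 1)) (2 * R + 3)) :=
    fun i U V hUV => by simp only [isCylinder_plane_cube r hR (q i) (x i) hUV]
  have hinj : ∀ i : Fin n, Set.InjOn (Torus.proj M)
      (((cubeEdges (fun k => x i k - (R + 1)) (2 * R + 3) ∪ cubeEdges (fun k => x i k - (R + 1)) (2 * R + 3) ∪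
          (plaquettesTouching (cubeEdges (fun k => x i k - (R + 1)) (2 * R + 3))).biUnion plaquetteEdges).image
          Prod.fst : Set (Fin 4 → ℤ))) := fun i => injOn_torusProj_cube_side hRM (x i)
  have hfar : ∀ i j : Fin n, i ≠ j → ∀ e ∈ cubeEdges (fun k => x j k - (R + 1)) (2 * R + 3) ∪
      (plaquettesTouching (cubeEdges (fun k => x j k - (R + 1)) (2 * R + 3))).biUnion plaquetteEdges,
      ∀ e' ∈ cubeEdges (fun k => x i k - (R + 1)) (2 * R + 3),
      torusEdge M e ≠ torusEdge M e' :=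
    fun i j hij e he e' he' => torusEdge_ne_cube_side (hsep i j hij) he he'
  have hm : ∀ i : Fin n, torusEOn G r β M (plane G r (q i) (x i)) - p (q i) β =
      ∫ W, (plane G r (q i) (x i) (torusLift M W) - p (q i) β)
        ∂(wilsonMeasure (d := 4) (L := M) r.ρ β) := fun i =>
    (integral_sub_const_of_abs_le (μ := wilsonMeasure (d := 4) (L := M) r.ρ β)
      ((continuous_plane r (q i) (x i)).comp (continuous_torusLift M)).measurable
      (fun W => hCA (q i) (x i) (torusLift M W)) (p (q i) β)).symm
  have hker : ∀ (i : Fin n), ∀ η ∈ Good β R (q i) (x i),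
      |(∫ U, (plane G r (q i) (x i) U - p (q i) β) ∂(ymSpecification r.ρ β
        (cubeEdges (fun k => x i k - (R + 1)) (2 * R + 3)) η)) - 0| ≤ C₁ / (R : ℝ) ^ 4 := fun i η hη => by
    haveI := isProbabilityMeasure_ymSpecification r.ρ r.continuous β
      (cubeEdges (fun k => x i k - (R + 1)) (2 * R + 3)) η
    rw [sub_zero, integral_sub_const_of_abs_le (hmeas i) (fun U => hCA (q i) (x i) U) (p (q i) β)]
    exact hlaw β hβ R hR hRa (q i) (x i) (hq i) η hη
  have hrare' : ∀ T : Finset (Fin n),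
      ∫ V, ∏ i ∈ T, (Good β R (q i) (x i))ᶜ.indicator (fun _ => (1 : ℝ)) (torusLift M V)
        ∂(wilsonMeasure (d := 4) (L := M) r.ρ β) ≤ (C₂ / (R : ℝ) ^ 4) ^ T.card :=
    fun T => hrare β hβ M hM n q x R hq hR hRa hRM hsep T
  have key := abs_integral_prod_sub_mean_le_of_defects (d := 4) r.ρ r.continuous β (L := M) (n := n)
      (fun i => cubeEdges (fun k => x i k - (R + 1)) (2 * R + 3))
      (fun i => cubeEdges (fun k => x i k - (R + 1)) (2 * R + 3))
      (fun i U => plane G r (q i) (x i) U - p (q i) β) hAc hAb hAS hinj hfar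
      (fun i => torusEOn G r β M (plane G r (q i) (x i)) - p (q i) β) hm
      (fun i => Good β R (q i) (x i)) (fun i => hGood β R (q i) (x i))
      (p := 0) (ε := C₁ / (R : ℝ) ^ 4) (δ := C₂ / (R : ℝ) ^ 4) (by positivity) (by positivity) hker hrare'
  simp only [sub_sub_sub_cancel_right, abs_zero, add_zero] at key
  refine key.trans (le_of_eq ?_)
  congr 1
  field_simp

end Route

/-! ## §4 The ADDITIVE (tame) collar: single-event rarity, explicit error (lead ym-spine-20043-p1 g7, ORDER 09:03Z item (3)) -/

section Tame

variable {d N : ℕ} {G : Type*} [Group G] [TopologicalSpace G] [IsTopologicalGroup G]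
  [CompactSpace G] [MeasurableSpace G] [BorelSpace G] [SecondCountableTopology G]
  (ρ : G →* Matrix (Fin N) (Fin N) ℂ)

/-- **The tame collar (additive error).**  In the geometry of the collar identity, if the kernel means are within `ε`
of `p` on GOOD exteriors `Goodᵢ` and each bad event is merely RARE under the torus state, `∫ 1_{Goodᵢᶜ}(lift V) dμ ≤ δ`
(no multiplicativity), then `|⟨∏ᵢ(Aᵢ − ⟨Aᵢ⟩)⟩| ≤ ε'ⁿ + n·(ε' + K)ⁿ·δ` with `ε' = 2ε + Kδ`, `K = C_A + |p|`: on the event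
that every lifted exterior is good the collared product is at most `ε'ⁿ`, elsewhere at most `(ε' + K)ⁿ`, and the bad
event has probability at most `Σᵢ μ(Badᵢ) ≤ nδ`.  This is the form a FIXED number of insertions consumes (two-point
ceilings, the floors side); for the `n`-uniform currency `MomentBounds6` the multiplicative form
`abs_integral_prod_sub_mean_le_of_defects` is needed. [folklore: Georgii (2011) Thm. 4.17 for the DLR part] -/
theorem abs_integral_prod_sub_mean_le_of_tame (hρ : Continuous ρ) (β : ℝ) {L : ℕ} [NeZero L] {n : ℕ}
    (Λ S : Fin n → Finset (ZdEdge d))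
    (A : Fin n → LGConfig d G → ℝ) (hAc : ∀ i, Continuous (A i)) {CA : ℝ} (hAb : ∀ i U, |A i U| ≤ CA)
    (hAS : ∀ i, IsCylinder (A i) (S i))
    (hinj : ∀ i, Set.InjOn (Torus.proj L)
      ((Λ i ∪ S i ∪ (plaquettesTouching (Λ i)).biUnion plaquetteEdges).image Prod.fst : Set (Site d)))
    (hfar : ∀ i j, i ≠ j → ∀ e ∈ S j ∪ (plaquettesTouching (Λ j)).biUnion plaquetteEdges, ∀ e' ∈ Λ i,
      torusEdge L e ≠ torusEdge L e')
    (m : Fin n → ℝ) (hm : ∀ i, m i = ∫ W, A i (torusLift L W) ∂(wilsonMeasure ρ β))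
    (Good : Fin n → Set (LGConfig d G)) (hGood : ∀ i, MeasurableSet (Good i))
    {p ε δ : ℝ} (hε : 0 ≤ ε) (hδ : 0 ≤ δ)
    (hker : ∀ i, ∀ η ∈ Good i, |(∫ U, A i U ∂(ymSpecification ρ β (Λ i) η)) - p| ≤ ε)
    (hrare : ∀ i, ∫ V, (Good i)ᶜ.indicator (fun _ => (1 : ℝ)) (torusLift L V) ∂(wilsonMeasure ρ β) ≤ δ) :
    |∫ V, ∏ i, (A i (torusLift L V) - m i) ∂(wilsonMeasure ρ β)| ≤
      (2 * ε + (CA + |p|) * δ) ^ n + n * (2 * ε + (CA + |p|) * δ + (CA + |p|)) ^ n * δ := by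
  classical
  haveI := isProbabilityMeasure_wilsonMeasure (d := d) (L := L) ρ hρ β
  rw [integral_prod_sub_mean_eq_integral_prod_collared ρ hρ β Λ S A hAc hAb hAS hinj hfar m]
  -- kernel means, bad indicators
  set g : Fin n → LGConfig d G → ℝ := fun i η => ∫ U, A i U ∂(ymSpecification ρ β (Λ i) η) with hgdef
  have hgc : ∀ i, Continuous (g i) := fun i =>
    continuous_integral_ymSpecification ρ hρ β (Λ i) (hAc i) (hAb i)
  have hgb : ∀ i η, |g i η| ≤ CA := fun i η => abs_integral_ymSpecification_le ρ hρ β (Λ i) (hAb i) η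
  have hgm : ∀ i, Measurable fun V : GaugeConfig d L G => g i (torusLift L V) := fun i =>
    ((hgc i).comp (continuous_torusLift L)).measurable
  set χ : Fin n → LGConfig d G → ℝ := fun i => (Good i)ᶜ.indicator (fun _ => (1 : ℝ)) with hχdef
  have hχm : ∀ i, Measurable fun V : GaugeConfig d L G => χ i (torusLift L V) := fun i =>
    (measurable_const.indicator (hGood i).compl).comp (measurable_torusLift L)
  have hχ0 : ∀ i η, 0 ≤ χ i η := fun i η => by
    simp only [hχdef]
    exact Set.indicator_nonneg (fun _ _ => zero_le_one) _
  have hχ1 : ∀ i η, χ i η ≤ 1 := fun i η => by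
    simp only [hχdef]
    exact Set.indicator_apply_le' (fun _ => le_rfl) (fun _ => zero_le_one)
  have hχb : ∀ i η, |χ i η| ≤ 1 := fun i η => by
    rw [abs_of_nonneg (hχ0 i η)]; exact hχ1 i η
  -- the degenerate case `n = 0`
  rcases Nat.eq_zero_or_pos n with hn | hn
  · subst hn
    simp
  obtain ⟨i₀⟩ : Nonempty (Fin n) := ⟨⟨0, hn⟩⟩
  have hCA : 0 ≤ CA := (abs_nonneg _).trans (hAb i₀ fun _ => 1)
  set K : ℝ := CA + |p| with hKdef
  have hK : 0 ≤ K := by positivity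
  -- the torus mean is the torus mean of the kernel mean
  have hm' : ∀ i, m i = ∫ V, g i (torusLift L V) ∂(wilsonMeasure ρ β) := fun i => by
    have h1 := integral_torusLift_mul_eq_integral_ymSpecification_mul ρ hρ β (Λ i) (hAc i) (hAb i)
      (hAS i) (hinj i) (H := fun _ => (1 : ℝ)) measurable_const (D := 1) (fun _ => by simp)
      (fun _ _ => rfl)
    rw [hm i]
    simpa [hgdef] using h1
  -- good/bad split of the kernel law
  have hgp : ∀ i η, |g i η - p| ≤ ε + K * χ i η := by
    intro i η
    by_cases hη : η ∈ Good i
    · have h0 : χ i η = 0 := by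
        have : η ∉ (Good i)ᶜ := fun h => h hη
        simp only [hχdef, Set.indicator_of_notMem this]
      rw [h0, mul_zero, add_zero]
      exact hker i η hη
    · have h1 : χ i η = 1 := by
        simp only [hχdef, Set.indicator_of_mem (Set.mem_compl hη)]
      rw [h1, mul_one]
      calc |g i η - p| ≤ |g i η| + |p| := abs_sub _ _
        _ ≤ CA + |p| := add_le_add_left (hgb i η) _
        _ ≤ ε + K := by rw [hKdef]; linarith
  have hrare1 : ∀ i, ∫ V, χ i (torusLift L V) ∂(wilsonMeasure ρ β) ≤ δ := fun i => by
    simpa only [hχdef] using hrare i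
  -- the torus means are within `ε + K δ` of `p`
  have hmp : ∀ i, |m i - p| ≤ ε + K * δ := by
    intro i
    have e1 : m i - p = ∫ V, (g i (torusLift L V) - p) ∂(wilsonMeasure ρ β) := by
      rw [hm' i, integral_sub_const_of_abs_le (hgm i) (fun V => hgb i _) p]
    rw [e1]
    calc |∫ V, (g i (torusLift L V) - p) ∂(wilsonMeasure ρ β)|
        ≤ ∫ V, |g i (torusLift L V) - p| ∂(wilsonMeasure ρ β) := abs_integral_le_integral_abs
      _ ≤ ∫ V, (ε + K * χ i (torusLift L V)) ∂(wilsonMeasure ρ β) := by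
          refine integral_mono_of_nonneg (ae_of_all _ fun V => abs_nonneg _) ?_ (ae_of_all _ fun V => hgp i _)
          exact (integrable_const ε).add
            ((integrable_of_abs_le (hχm i) (fun V => hχb i _)).const_mul K)
      _ = ε + K * ∫ V, χ i (torusLift L V) ∂(wilsonMeasure ρ β) := by
          rw [integral_add (integrable_const ε)
            ((integrable_of_abs_le (hχm i) (fun V => hχb i _)).const_mul K),
            integral_const, integral_const_mul]
          simp
      _ ≤ ε + K * δ := by gcongr; exact hrare1 i
  -- pointwise bounds on the collared factors
  set ε' : ℝ := 2 * ε + K * δ with hε'def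
  have hε' : 0 ≤ ε' := by positivity
  have hh : ∀ i η, |g i η - m i| ≤ ε' + K * χ i η := by
    intro i η
    have e1 : g i η - m i = (g i η - p) - (m i - p) := by ring
    rw [e1]
    calc |(g i η - p) - (m i - p)| ≤ |g i η - p| + |m i - p| := abs_sub _ _
      _ ≤ (ε + K * χ i η) + (ε + K * δ) := add_le_add (hgp i η) (hmp i)
      _ = ε' + K * χ i η := by rw [hε'def]; ring
  have hhK : ∀ i η, |g i η - m i| ≤ ε' + K := fun i η =>
    (hh i η).trans (by nlinarith [hχ1 i η, hK])
  -- pointwise: good everywhere ⇒ `ε'ⁿ`, else `(ε' + K)ⁿ`, and the bad event is covered by `Σ χᵢ`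
  have hpt : ∀ V : GaugeConfig d L G, |∏ i, (g i (torusLift L V) - m i)| ≤
      ε' ^ n + (ε' + K) ^ n * ∑ i, χ i (torusLift L V) := by
    intro V
    have hsum0 : 0 ≤ ∑ i, χ i (torusLift L V) := Finset.sum_nonneg fun i _ => hχ0 i _
    by_cases hall : ∀ i, torusLift L V ∈ Good i
    · have h1 : |∏ i, (g i (torusLift L V) - m i)| ≤ ε' ^ n := by
        have := abs_prod_le_pow (Finset.univ : Finset (Fin n)) (f := fun i (W : GaugeConfig d L G) =>
          g i (torusLift L V) - m i) (B := ε') (fun i _ W => by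
            have h0 : χ i (torusLift L V) = 0 := by
              have : torusLift L V ∉ (Good i)ᶜ := fun h => h (hall i)
              simp only [hχdef, Set.indicator_of_notMem this]
            have := hh i (torusLift L V)
            rw [h0, mul_zero, add_zero] at this
            exact this) V
        simpa [Finset.card_univ, Fintype.card_fin] using this
      exact h1.trans (le_add_of_nonneg_right (mul_nonneg (pow_nonneg (by positivity) _) hsum0))
    · obtain ⟨j, hj⟩ := not_forall.1 hall
      have hχj : χ j (torusLift L V) = 1 := by
        simp only [hχdef, Set.indicator_of_mem (Set.mem_compl hj)]
      have hsum1 : 1 ≤ ∑ i, χ i (torusLift L V) := by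
        rw [← hχj]
        exact Finset.single_le_sum (f := fun i => χ i (torusLift L V)) (fun i _ => hχ0 i _) (Finset.mem_univ j)
      have h2 : |∏ i, (g i (torusLift L V) - m i)| ≤ (ε' + K) ^ n := by
        have := abs_prod_le_pow (Finset.univ : Finset (Fin n)) (f := fun i (W : GaugeConfig d L G) =>
          g i (torusLift L V) - m i) (B := ε' + K) (fun i _ W => hhK i _) V
        simpa [Finset.card_univ, Fintype.card_fin] using this
      calc |∏ i, (g i (torusLift L V) - m i)| ≤ (ε' + K) ^ n := h2
        _ = (ε' + K) ^ n * 1 := (mul_one _).symm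
        _ ≤ (ε' + K) ^ n * ∑ i, χ i (torusLift L V) :=
            mul_le_mul_of_nonneg_left hsum1 (pow_nonneg (by positivity) _)
        _ ≤ ε' ^ n + (ε' + K) ^ n * ∑ i, χ i (torusLift L V) := le_add_of_nonneg_left (pow_nonneg hε' _)
  -- integrate
  have hint_sum : Integrable (fun V : GaugeConfig d L G => ∑ i, χ i (torusLift L V)) (wilsonMeasure ρ β) :=
    integrable_finsetSum _ fun i _ => integrable_of_abs_le (hχm i) (fun V => hχb i _)
  calc |∫ V, ∏ i, (g i (torusLift L V) - m i) ∂(wilsonMeasure ρ β)|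
      ≤ ∫ V, |∏ i, (g i (torusLift L V) - m i)| ∂(wilsonMeasure ρ β) := abs_integral_le_integral_abs
    _ ≤ ∫ V, (ε' ^ n + (ε' + K) ^ n * ∑ i, χ i (torusLift L V)) ∂(wilsonMeasure ρ β) :=
        integral_mono_of_nonneg (ae_of_all _ fun V => abs_nonneg _)
          ((integrable_const _).add (hint_sum.const_mul _)) (ae_of_all _ hpt)
    _ = ε' ^ n + (ε' + K) ^ n * ∑ i, ∫ V, χ i (torusLift L V) ∂(wilsonMeasure ρ β) := by
        rw [integral_add (integrable_const _) (hint_sum.const_mul _), integral_const, integral_const_mul,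
          integral_finsetSum _ fun i _ => integrable_of_abs_le (hχm i) (fun V => hχb i _)]
        simp
    _ ≤ ε' ^ n + (ε' + K) ^ n * ∑ _i : Fin n, δ := by
        gcongr with i _
        · exact hrare1 i
    _ = (2 * ε + (CA + |p|) * δ) ^ n + n * (2 * ε + (CA + |p|) * δ + (CA + |p|)) ^ n * δ := by
        rw [Finset.sum_const, Finset.card_univ, Fintype.card_fin, nsmul_eq_mul, hε'def, hKdef]
        ring

end Tame

end Summit.QuantumFields.YangMills.Cruxes.UVSeamRec.DefectCollar

end
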